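import Literature.Geometry.Lorentzian.CarterCapMonotone
import Literature.Geometry.Lorentzian.CarterNearZone
import HarnessLib

/-!
# The sharp sup bound of the horizon-normalised solution on the cap in the superradiant
# Breitenlohner–Freedman-stable regime: `‖u_𝓗‖ ≤ 2 + √2|σ|·L`
(namespace `Literature.Geometry.Lorentzian.Kerr`.)

Continuation of `CarterCapMonotone.lean` (`carter_cap_soninEnergy_le`: on the cap, `φ‖u_𝓗‖² + ‖u_𝓗′‖² ≤ 2σ²`,
`σ = ω − mω₊`). Two consequences give the sup envelope `P_u` of `u_𝓗` on the cap `(−∞, b₁]` consumed by the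
deep-barrier kernel bound (`Literature.Analysis.ODE.kernel_le_of_deep_barrier`):

* on the HORIZON ZONE `ρ s − r₊ ≤ σ²M³/(416Λ)` the coefficient is `≥ σ²/2`
  (`Kerr.coeff_mem_Icc_of_horizonZone`), so `‖u_𝓗 s‖² ≤ 4`;
* beyond it, `‖u_𝓗′‖ ≤ √2|σ|` (mean value inequality) over the tame length
  `b₁ − x_a ≤ L := (25/κ)·log(2496Λ/(σ²M²))` (`IsTortoiseRadius.tameZone_length_le`, `ρ b₁ ≤ 7M`).

* `carter_cap_norm_le` — for `s ≤ b₁`: `‖u_𝓗 s‖ ≤ 2 + √2|σ|·L` and `‖u_𝓗′ s‖ ≤ √2|σ|` (`Λ ≥ 1`,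
  `σ²M² ≤ Λ`, `φ ≥ 0` on `(−∞, b₁]`, `ρ b₁ ≤ r₊(1 + θ₁/8)`, superradiant BF-stable regime with `Λ′ ≥ 100`).

Polynomial in `|σ|/κ` and `log Λ` only — no `(Φ/η²)^16·e^{2ηL}` loss (compare `Kerr.carter_envelope_H`).
All proved.

## References
* M. Dafermos, I. Rodnianski, Y. Shlapentokh-Rothman, arXiv:1402.7034 = Ann. of Math. 183 (2016),
  §§2.1.2, 5.2.3, 6.3 (key `DafermosRodnianskiShlapentokhrothman2014`). Folklore otherwise.
-/

noncomputable section

open Set Filter Literature.Analysis.ODE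
open scoped _root_.Topology

namespace Literature.Geometry.Lorentzian

namespace Kerr

section CapSup

variable {M a ω Λ : ℝ} {m : ℤ} {ρ : ℝ → ℝ} {u u₁ : ℝ → ℂ}

/-- **Sharp cap envelope of the `𝓗⁺`-data solution.** Along a tortoise radius of a sub-extremal exterior,
for an admissible triple with `Λ ≥ 1` and `σ²M² ≤ Λ`, in the superradiant BF-stable regime (`0 < θ₁ ≤ 1`,
margin, `ωσ < 0`, `Λ′ ≥ 100`), if `ω² − V(ρ s) ≥ 0` for all `s ≤ b₁` and `ρ b₁ ≤ r₊(1 + θ₁/8)`, then for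
every `s ≤ b₁`: `‖u s‖ ≤ 2 + √2|σ|·(25/κ)log(2496Λ/(σ²M²))` and `‖u′ s‖ ≤ √2|σ|`. [folklore] -/
theorem carter_cap_norm_le (hρ : IsTortoiseRadius M a ρ) (hMa : IsSubextremal M a)
    (hadm : IsAdmissibleTriple a ω m Λ) (hΛ : 1 ≤ Λ)
    (hσΛ : (ω - m * horizonAngularVelocity M a) ^ 2 * M ^ 2 ≤ Λ)
    {θ₁ : ℝ} (hθ₁ : 0 < θ₁) (hθ₁1 : θ₁ ≤ 1)
    (hmargin : (1 + θ₁) * (2 * rPlus M a * ω) ^ 2 ≤ Λ - 2 * a * m * ω)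
    (hωσ : ω * (ω - m * horizonAngularVelocity M a) < 0)
    (hΛ' : 100 ≤ Λ - 2 * a * m * ω)
    (hu : ∀ x, HasDerivAt u (u₁ x) x ∧
      HasDerivAt u₁ (-(((ω ^ 2 - sepPotential M a ω m Λ (ρ x) : ℝ) : ℂ) * u x)) x)
    (hlim : Tendsto (fun x ↦ ‖u x‖) atBot (𝓝 1))
    (hlim₁ : Tendsto (fun x ↦ ‖u₁ x‖) atBot (𝓝 |ω - m * horizonAngularVelocity M a|))
    {b₁ : ℝ} (hcap : ∀ s, s ≤ b₁ → 0 ≤ ω ^ 2 - sepPotential M a ω m Λ (ρ s))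
    (hb : ρ b₁ ≤ rPlus M a * (1 + θ₁ / 8)) {s : ℝ} (hs : s ≤ b₁) :
    ‖u s‖ ≤ 2 + Real.sqrt 2 * |ω - m * horizonAngularVelocity M a| *
        (25 / surfaceGravity M a *
          Real.log (2496 * Λ / ((ω - m * horizonAngularVelocity M a) ^ 2 * M ^ 2))) ∧
      ‖u₁ s‖ ≤ Real.sqrt 2 * |ω - m * horizonAngularVelocity M a| := by
  have hM : 0 < M := hMa.pos
  set σ := ω - m * horizonAngularVelocity M a with hσdef
  set L := 25 / surfaceGravity M a * Real.log (2496 * Λ / (σ ^ 2 * M ^ 2)) with hL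
  have hσ0 : σ ≠ 0 := fun e ↦ by rw [e, mul_zero] at hωσ; exact lt_irrefl _ hωσ
  have hσ2 : 0 < σ ^ 2 := by positivity
  have hκ : 0 < surfaceGravity M a := hMa.surfaceGravity_pos
  -- Sonin: `φ‖u‖² + ‖u′‖² ≤ 2σ²` on the cap
  have hson : ∀ t, t ≤ b₁ → (ω ^ 2 - sepPotential M a ω m Λ (ρ t)) * ‖u t‖ ^ 2 + ‖u₁ t‖ ^ 2 ≤ 2 * σ ^ 2 ∧
      ‖u₁ t‖ ^ 2 ≤ 2 * σ ^ 2 := fun t ht ↦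
    carter_cap_soninEnergy_le hρ hMa hθ₁ hθ₁1 hmargin hωσ hΛ' hu hlim hlim₁ hcap hb ht
  -- derivative bound everywhere on the cap
  have hder : ∀ t, t ≤ b₁ → ‖u₁ t‖ ≤ Real.sqrt 2 * |σ| := by
    intro t ht
    have h := (hson t ht).2
    have e : (Real.sqrt 2 * |σ|) ^ 2 = 2 * σ ^ 2 := by
      rw [mul_pow, Real.sq_sqrt (by norm_num : (0:ℝ) ≤ 2), sq_abs]
    rw [← e] at h
    exact le_of_pow_le_pow_left₀ two_ne_zero (by positivity) h
  refine ⟨?_, hder s hs⟩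
  -- `L ≥ 0`
  have hL0 : 0 ≤ L := by
    have hQ : 1 ≤ 2496 * Λ / (σ ^ 2 * M ^ 2) := by
      rw [le_div_iff₀ (by positivity), one_mul]
      calc σ ^ 2 * M ^ 2 ≤ Λ := hσΛ
        _ ≤ 2496 * Λ := by linarith
    exact mul_nonneg (div_nonneg (by norm_num) hκ.le) (Real.log_nonneg hQ)
  have hC0 : 0 ≤ Real.sqrt 2 * |σ| := by positivity
  -- the horizon zone edge `xa`
  have hxap : rPlus M a < rPlus M a + σ ^ 2 * M ^ 3 / (416 * Λ) := lt_add_of_pos_right _ (by positivity)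
  obtain ⟨xa, hxa⟩ := hρ.exists_apply_eq hxap
  -- `‖u t‖ ≤ 2` on the horizon-zone part of the cap
  have hzone : ∀ t, t ≤ xa → t ≤ b₁ → ‖u t‖ ≤ 2 := by
    intro t ht htb
    have ht' : ρ t - rPlus M a ≤ σ ^ 2 * M ^ 3 / (416 * Λ) := by
      have := (hρ.strictMono hMa).monotone ht; rw [hxa] at this; linarith
    have hφ := (coeff_mem_Icc_of_horizonZone hρ hMa hadm hΛ ht').1
    have h := (hson t htb).1
    have h1 : σ ^ 2 / 2 * ‖u t‖ ^ 2 ≤ 2 * σ ^ 2 := by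
      have := mul_le_mul_of_nonneg_right hφ (sq_nonneg ‖u t‖)
      linarith [sq_nonneg ‖u₁ t‖]
    have h2 : ‖u t‖ ^ 2 ≤ 2 ^ 2 := by
      have h3 : σ ^ 2 * ‖u t‖ ^ 2 ≤ σ ^ 2 * 4 := by linarith
      have h4 := le_of_mul_le_mul_left h3 hσ2
      linarith
    exact le_of_pow_le_pow_left₀ two_ne_zero (by norm_num) h2
  rcases le_or_gt s xa with hsa | hsa
  · have h1 := hzone s hsa hs
    have : 0 ≤ Real.sqrt 2 * |σ| * L := mul_nonneg hC0 hL0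
    linarith
  · -- mean value inequality on `[xa, s]`, then the tame length `s − xa ≤ b₁ − xa ≤ L`
    have hmv : ‖u s - u xa‖ ≤ Real.sqrt 2 * |σ| * (s - xa) := by
      have h := norm_image_sub_le_of_norm_deriv_le_segment' (f := u) (f' := u₁) (a := xa) (b := s)
        (fun x _ ↦ (hu x).1.hasDerivWithinAt)
        (fun x hx ↦ hder x (hx.2.le.trans hs)) s (right_mem_Icc.2 hsa.le)
      exact h
    have hxab : xa ≤ b₁ := hsa.le.trans hs
    have hb₁7 : ρ b₁ ≤ 7 * M := by
      have : rPlus M a * (1 + θ₁ / 8) ≤ (2 * M) * (9 / 8) :=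
        mul_le_mul (rPlus_le_two_mul_self hM.le a) (by linarith) (by positivity) (by positivity)
      linarith
    have hlen : b₁ - xa ≤ L := hρ.tameZone_length_le hMa hσ0 hΛ hxa.ge hxab hb₁7
    have h2 : ‖u xa‖ ≤ 2 := hzone xa le_rfl hxab
    have h3 : Real.sqrt 2 * |σ| * (s - xa) ≤ Real.sqrt 2 * |σ| * L :=
      mul_le_mul_of_nonneg_left (by linarith) hC0
    calc ‖u s‖ = ‖u xa + (u s - u xa)‖ := by congr 1; ring
      _ ≤ ‖u xa‖ + ‖u s - u xa‖ := norm_add_le _ _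
      _ ≤ 2 + Real.sqrt 2 * |σ| * L := by linarith

end CapSup

end Kerr

end Literature.Geometry.Lorentzian

end
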